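import Literature.Geometry.Lorentzian.KerrData
import Literature.Geometry.Lorentzian.KerrHyperboloidalLeaves
import Literature.Geometry.Lorentzian.KerrStarChartBounds
import Literature.Geometry.Lorentzian.ModelDataProofs
import HarnessLib

/-!
# `KerrShieldedDataExist` — the UNBENT Kerr–Schild end is not DR-admissible (part 6):
# discharge of the named fact `Kerr.not_isStronglyAsymptoticallyFlatDR_data`

Negative-side lemma for crux `stmt-FinalStateConjecture-10055` (route SwallowTheDatum; standing disprover,
gen 3). The route bends the shielding slice to Boyer–Lindquist time beyond `8M` BECAUSE the pure
Kerr–Schild end fails the Dafermos–Rodnianski rates of `admissibleVacuumData`; so far this was the UNPROVED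
named fact `Kerr.not_isStronglyAsymptoticallyFlatDR_data` (`KerrData.lean`), cited by four route files and by
the disprover's refuted mutation "unbent slice + tautological chart" (work file §7). This file PROVES it, for
every `M > 0`, every spin `a`, every inner radius `r₀` and EVERY template mass `M'`:

* already the metric part at order `m = 0` fails: in the tautological chart of `Kerr.afEnd`,
  `hCoeff = h = δ + 2H ℓ⃗ ⊗ ℓ⃗` (`hCoeff_afEnd_data_apply`), and for the test form
  `B = h − (1 + 2M'/‖x‖) δ` one has `B(ℓ⃗, ℓ⃗) = 2H − 2M'/‖x‖` and `∑ᵢ B(eᵢ, eᵢ) = 2H − 6M'/‖x‖`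
  (`|ℓ⃗| = 1`), so `3B(ℓ⃗,ℓ⃗) − ∑ᵢ B(eᵢ,eᵢ) = 4H` whatever `M'` is, whence `‖B‖ ≥ (2/3) H`
  (`norm_testForm_ge`);
* `H(0, x) = M r/Σ ≥ (2/5) M/‖x‖` once `‖x‖ ≥ 2|a|` (`r ≥ ‖x‖/2`, `Σ ≤ r² + a²`; `scalarH_slice_ge`);
* hence `‖B(x)‖ ≥ (4/15) M/‖x‖` far out, contradicting `B = o(‖x‖⁻¹)` along `cobounded E3`
  (`not_isStronglyAsymptoticallyFlatDR_data_holds`). No second fundamental form and no derivative is needed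
  (the printed argument uses `tr k ∼ 2M/r²`; the anisotropic `O(1/r)` part of `h` is the cheaper witness).

Consequence recorded for the crux: the `T ≡ 0` (unbent) variant of the shield with the tautological end chart
is not admissible — any witness must bend (as the hard-coded `T_{M,a}` does) or re-chart the end.
-/

noncomputable section

open Filter Asymptotics Bornology
open scoped Manifold ContDiff Topology RealInnerProductSpace
open Literature.Geometry.Lorentzian

namespace Summit.FinalStateConjecture.FinalStateConjecture.Theorems.KerrShieldedDataExist.Negative

section UnbentEnd

variable {M a r₀ : ℝ}

/-! ## The Kerr data in the tautological chart of `Kerr.afEnd` -/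

/-- The inverse chart of the Kerr end is the identity on coordinates. [cite: Bartnik1986, §1] -/
theorem coe_dataChart_afEnd (y : exteriorRegion (Kerr.afEnd a r₀).R) :
    (((Kerr.afEnd a r₀).dataChart y : Kerr.slice a r₀) : E3) = y := rfl

/-- Hence its differential is the identity (`OpensChart.mfderiv_apply_of_coe_eq`). [cite: Bartnik1986, §1] -/
theorem mfderiv_dataChart_afEnd_apply (y : exteriorRegion (Kerr.afEnd a r₀).R) (v : E3) :
    mfderiv (𝓡 3) (𝓡 3) (Kerr.afEnd a r₀).dataChart y v = v :=
  OpensChart.mfderiv_apply_of_coe_eq _ coe_dataChart_afEnd y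
    (((Kerr.afEnd a r₀).contMDiff_dataChart y).mdifferentiableAt (by simp)) v

/-- **In the tautological chart the components of the Kerr data ARE `h = δ + 2H ℓ⃗ ⊗ ℓ⃗`**: on the
diagonal, `hCoeff x (v, v) = ‖v‖² + 2H(0,x) ℓ(0,v)²` (Cook 2000, §3.2.2, (55)). [cite: Cook2000, §3.2.2 (55)] -/
theorem hCoeff_afEnd_data_apply [Kerr.Facts] [Kerr.SliceFacts] (hM : 0 ≤ M) {x : E3}
    (hx : (Kerr.afEnd a r₀).R < ‖x‖) (v : E3) :
    AFEnd.hCoeff (Kerr.afEnd a r₀) (Kerr.data M a r₀ hM) x v v =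
      ‖v‖ ^ 2 + 2 * Kerr.scalarH M a (E4.ofTimeSpace 0 x) *
        Kerr.nullCovector a (E4.ofTimeSpace 0 x) (E4.spaceEmbed v) ^ 2 := by
  rw [AFEnd.hCoeff_of_lt (e := Kerr.afEnd a r₀) (Kerr.data M a r₀ hM) hx]
  have key : ∀ (p : Kerr.slice a r₀) (_ : p = (Kerr.afEnd a r₀).dataChart ⟨x, hx⟩) (v' : E3) (_ : v' = v)
      (w' : E3) (_ : w' = v),
      (Kerr.data M a r₀ hM).h.inner p v' w' =
        ‖v‖ ^ 2 + 2 * Kerr.scalarH M a (E4.ofTimeSpace 0 x) *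
          Kerr.nullCovector a (E4.ofTimeSpace 0 x) (E4.spaceEmbed v) ^ 2 := by
    rintro p rfl v' rfl w' rfl
    rw [Kerr.data_h_inner, PseudoRiemannianMetric.inducedBilin_apply, Kerr.mfderiv_sliceEmbed,
      Kerr.smoothMetric_val, Kerr.coe_sliceEmbed]
    exact Kerr.bilin_spaceEmbed_spaceEmbed M a _ _
  exact (pullbackBilin_apply (I := 𝓡 3) (I' := 𝓡 3) _ _ _ v v).trans
    (key _ rfl _ (mfderiv_dataChart_afEnd_apply _ v) _ (mfderiv_dataChart_afEnd_apply _ v))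

/-- `ℓ(0, v) = ℓ₁ v₀ + ℓ₂ v₁ + ℓ₃ v₂` (`ℓ⃗ · v`). [cite: arXiv07060622, (34)] -/
theorem nullCovector_spaceEmbed (a : ℝ) (x : E4) (v : E3) :
    Kerr.nullCovector a x (E4.spaceEmbed v) =
      Kerr.nullCovectorFun a x 1 * v 0 + Kerr.nullCovectorFun a x 2 * v 1 + Kerr.nullCovectorFun a x 3 * v 2 := by
  rw [Kerr.nullCovector, E4.covector_apply, Fin.sum_univ_succ, Fin.sum_univ_three]
  simp only [E4.spaceEmbed_apply, E4.ofTimeSpace_apply_zero, E4.ofTimeSpace_apply_succ, mul_zero, zero_add,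
    Fin.succ_zero_eq_one, Fin.succ_one_eq_two, Fin.isValue]
  rfl

/-! ## The test form `B = h − (1 + 2M'/‖x‖) δ` and the mass-independent combination `4H` -/

variable (M a r₀) in
/-- The order-zero DR test form at `x`: `B = hCoeff − (1 + 2M'/‖x‖) δ` (the function whose `o(‖x‖⁻¹)`
decay `IsStronglyAsymptoticallyFlatWith … 1 2 2 1` demands at `m = 0`). [cite: DafermosRodnianski2013, App. B.2.3] -/
def testForm [Kerr.Facts] [Kerr.SliceFacts] (hM : 0 ≤ M) (M' : ℝ) (x : E3) : E3 →L[ℝ] E3 →L[ℝ] ℝ :=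
  AFEnd.hCoeff (Kerr.afEnd a r₀) (Kerr.data M a r₀ hM) x -
    (1 + 2 * M' / ‖x‖) • (innerSL ℝ : E3 →L[ℝ] E3 →L[ℝ] ℝ)

/-- `B(v, v) = 2H ℓ(0,v)² − (2M'/‖x‖) ‖v‖²`. [cite: Cook2000, §3.2.2 (55)] -/
theorem testForm_apply_self [Kerr.Facts] [Kerr.SliceFacts] (hM : 0 ≤ M) (M' : ℝ) {x : E3}
    (hx : (Kerr.afEnd a r₀).R < ‖x‖) (v : E3) :
    testForm M a r₀ hM M' x v v =
      2 * Kerr.scalarH M a (E4.ofTimeSpace 0 x) * Kerr.nullCovector a (E4.ofTimeSpace 0 x) (E4.spaceEmbed v) ^ 2 -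
        2 * M' / ‖x‖ * ‖v‖ ^ 2 := by
  rw [testForm, sub_apply, sub_apply, hCoeff_afEnd_data_apply hM hx, smul_apply, smul_apply, innerSL_apply_apply,
    real_inner_self_eq_norm_sq, smul_eq_mul]
  ring

/-- `B(ℓ⃗, ℓ⃗) = 2H − 2M'/‖x‖` (`ℓ(0, ℓ⃗) = |ℓ⃗|² = 1`, `‖ℓ⃗‖ = 1`). [cite: arXiv07060622, (34)–(35)] -/
theorem testForm_nullSpatial [Kerr.Facts] [Kerr.SliceFacts] (hM : 0 ≤ M) (M' : ℝ) {x : E3}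
    (hx : (Kerr.afEnd a r₀).R < ‖x‖) (hr : 0 < Kerr.radius a (E4.ofTimeSpace 0 x)) :
    testForm M a r₀ hM M' x (Kerr.nullSpatial a (E4.ofTimeSpace 0 x)) (Kerr.nullSpatial a (E4.ofTimeSpace 0 x)) =
      2 * Kerr.scalarH M a (E4.ofTimeSpace 0 x) - 2 * M' / ‖x‖ := by
  have hℓ : Kerr.nullCovector a (E4.ofTimeSpace 0 x) (E4.spaceEmbed (Kerr.nullSpatial a (E4.ofTimeSpace 0 x))) = 1 := by
    rw [nullCovector_spaceEmbed, Kerr.nullSpatial_apply, Kerr.nullSpatial_apply, Kerr.nullSpatial_apply,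
      Fin.succ_zero_eq_one, Fin.succ_one_eq_two]
    have h := Kerr.sum_sq_nullCovectorFun hr
    have e3 : (2 : Fin 3).succ = 3 := rfl
    rw [e3]
    nlinarith [h]
  rw [testForm_apply_self hM M' hx, hℓ, Kerr.norm_nullSpatial_slice hr]
  ring

/-- `∑ᵢ B(eᵢ, eᵢ) = 2H − 6M'/‖x‖` (`ℓ(0, eᵢ) = ℓ_{i+1}`, `∑ ℓ_{i+1}² = 1`). [cite: arXiv07060622, (34)–(35)] -/
theorem sum_testForm_single [Kerr.Facts] [Kerr.SliceFacts] (hM : 0 ≤ M) (M' : ℝ) {x : E3}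
    (hx : (Kerr.afEnd a r₀).R < ‖x‖) (hr : 0 < Kerr.radius a (E4.ofTimeSpace 0 x)) :
    testForm M a r₀ hM M' x (EuclideanSpace.single 0 1) (EuclideanSpace.single 0 1) +
        testForm M a r₀ hM M' x (EuclideanSpace.single 1 1) (EuclideanSpace.single 1 1) +
        testForm M a r₀ hM M' x (EuclideanSpace.single 2 1) (EuclideanSpace.single 2 1) =
      2 * Kerr.scalarH M a (E4.ofTimeSpace 0 x) - 6 * M' / ‖x‖ := by
  have h := Kerr.sum_sq_nullCovectorFun hr
  rw [testForm_apply_self hM M' hx, testForm_apply_self hM M' hx, testForm_apply_self hM M' hx,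
    nullCovector_spaceEmbed, nullCovector_spaceEmbed, nullCovector_spaceEmbed]
  simp only [PiLp.single_apply, PiLp.norm_single, norm_one, one_pow, mul_one, mul_zero,
    add_zero, zero_add, if_true, Fin.isValue, show (1 : Fin 3) ≠ 0 from by decide,
    show (2 : Fin 3) ≠ 0 from by decide, show (0 : Fin 3) ≠ 1 from by decide, show (2 : Fin 3) ≠ 1 from by decide,
    show (0 : Fin 3) ≠ 2 from by decide, show (1 : Fin 3) ≠ 2 from by decide, if_false]
  linear_combination (2 * Kerr.scalarH M a (E4.ofTimeSpace 0 x)) * h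

/-- **`‖B‖ ≥ (2/3) H` for every template mass `M'`**: `4H = 3B(ℓ⃗,ℓ⃗) − ∑ᵢ B(eᵢ,eᵢ) ≤ 6‖B‖`
(`|B(v,v)| ≤ ‖B‖ ‖v‖²` on the four unit vectors). [folklore] -/
theorem norm_testForm_ge [Kerr.Facts] [Kerr.SliceFacts] (hM : 0 ≤ M) (M' : ℝ) {x : E3}
    (hx : (Kerr.afEnd a r₀).R < ‖x‖) (hr : 0 < Kerr.radius a (E4.ofTimeSpace 0 x)) :
    2 / 3 * Kerr.scalarH M a (E4.ofTimeSpace 0 x) ≤ ‖testForm M a r₀ hM M' x‖ := by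
  set B := testForm M a r₀ hM M' x with hB
  have bound : ∀ v : E3, ‖v‖ = 1 → |B v v| ≤ ‖B‖ := by
    intro v hv
    have := B.le_opNorm₂ v v
    rw [hv, mul_one, mul_one, Real.norm_eq_abs] at this
    exact this
  have h0 := bound _ (Kerr.norm_nullSpatial_slice hr)
  have h1 := bound (EuclideanSpace.single 0 1) (by rw [PiLp.norm_single, norm_one])
  have h2 := bound (EuclideanSpace.single 1 1) (by rw [PiLp.norm_single, norm_one])
  have h3 := bound (EuclideanSpace.single 2 1) (by rw [PiLp.norm_single, norm_one])
  have e0 := testForm_nullSpatial hM M' hx hr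
  have es := sum_testForm_single hM M' hx hr
  rw [← hB] at e0 es
  have key : 4 * Kerr.scalarH M a (E4.ofTimeSpace 0 x) =
      3 * B (Kerr.nullSpatial a (E4.ofTimeSpace 0 x)) (Kerr.nullSpatial a (E4.ofTimeSpace 0 x)) -
        (B (EuclideanSpace.single 0 1) (EuclideanSpace.single 0 1) +
          B (EuclideanSpace.single 1 1) (EuclideanSpace.single 1 1) +
          B (EuclideanSpace.single 2 1) (EuclideanSpace.single 2 1)) := by
    rw [e0, es]; ring
  have habs := fun v : E3 => le_abs_self (B v v)
  have habs' := fun v : E3 => neg_abs_le (B v v)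
  nlinarith [habs (Kerr.nullSpatial a (E4.ofTimeSpace 0 x)), habs' (EuclideanSpace.single 0 1),
    habs' (EuclideanSpace.single 1 1), habs' (EuclideanSpace.single 2 1), key]

/-! ## `H ≳ M/‖x‖` far out -/

/-- `r² ≥ ‖x‖² − a²` (from the quartic: `r²(r² − (‖x‖² − a²)) = a² z² ≥ 0`). [cite: arXiv07060622, (35)] -/
theorem norm_sq_sub_sq_le_radius_sq {x : E3} (hr : 0 < Kerr.radius a (E4.ofTimeSpace 0 x)) :
    ‖x‖ ^ 2 - a ^ 2 ≤ Kerr.radius a (E4.ofTimeSpace 0 x) ^ 2 := by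
  have hq := Kerr.radius_slice_quartic a x
  have hr2 : 0 < Kerr.radius a (E4.ofTimeSpace 0 x) ^ 2 := by positivity
  by_contra hlt
  rw [not_le] at hlt
  nlinarith [sq_nonneg (a * x 2), mul_pos hr2 (sub_pos.2 hlt)]

/-- **`H(0, x) ≥ (2/5) M/‖x‖` for `‖x‖ ≥ 2|a|`, `M ≥ 0`** (`H = Mr/Σ`, `r ≥ ‖x‖/2`, `Σ ≤ r² + a² ≤ (5/4)‖x‖²`).
[cite: arXiv07060622, (33)–(35)] -/
theorem scalarH_slice_ge (hM : 0 ≤ M) {x : E3} (hr : 0 < Kerr.radius a (E4.ofTimeSpace 0 x))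
    (hxa : 2 * |a| ≤ ‖x‖) (hx0 : 0 < ‖x‖) :
    2 / 5 * M / ‖x‖ ≤ Kerr.scalarH M a (E4.ofTimeSpace 0 x) := by
  set r := Kerr.radius a (E4.ofTimeSpace 0 x) with hrdef
  have hS := Kerr.blSigma_pos hr
  have hrle : r ≤ ‖x‖ := Kerr.radius_le_norm hr
  have hlow := norm_sq_sub_sq_le_radius_sq hr (a := a)
  rw [← hrdef] at hlow
  have ha2 : a ^ 2 ≤ ‖x‖ ^ 2 / 4 := by
    have h1 : |a| ≤ ‖x‖ / 2 := by linarith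
    have h2 : |a| ^ 2 ≤ (‖x‖ / 2) ^ 2 := pow_le_pow_left₀ (abs_nonneg a) h1 2
    rw [sq_abs] at h2
    nlinarith [h2]
  have hr_half : ‖x‖ / 2 ≤ r := by
    have h4 : (‖x‖ / 2) ^ 2 ≤ r ^ 2 := by nlinarith
    exact (abs_le_of_sq_le_sq' h4 hr.le).2
  have hSig : Kerr.blSigma a x ≤ 5 / 4 * ‖x‖ ^ 2 := by
    unfold Kerr.blSigma; nlinarith
  rw [Kerr.scalarH_ofTimeSpace_eq 0 hr, ← hrdef]
  rw [div_le_div_iff₀ hx0 hS]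
  nlinarith [mul_le_mul_of_nonneg_left hSig hM, mul_le_mul_of_nonneg_left hr_half hM, hM]

/-! ## The named fact -/

/-- **Discharge of `Kerr.not_isStronglyAsymptoticallyFlatDR_data`**: for `M > 0` the Kerr–Schild slice
data are NOT strongly asymptotically flat in the sense of Dafermos–Rodnianski on the Kerr–Schild end, for
any spin `a`, inner radius `r₀` and template mass `M'` — the order-zero metric rate
`h − (1 + 2M'/r)δ = o(r⁻¹)` already fails (`‖B‖ ≥ (4/15) M/‖x‖`). [cite: Cook2000, §3.2.2] [cite: DafermosRodnianski2013, App. B.2.3] -/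
theorem not_isStronglyAsymptoticallyFlatDR_data_holds [Kerr.Facts] [Kerr.SliceFacts] (M a r₀ : ℝ) :
    Kerr.not_isStronglyAsymptoticallyFlatDR_data M a r₀ := by
  intro hM M' hDR
  -- the `m = 0` metric clause of the DR rates
  have h0 := hDR.1 0 (by norm_num)
  have hM10 : 0 < M / 10 := by positivity
  have hev := h0.def hM10
  have hfar := eventually_cobounded_le_norm (E := E3) (max ((Kerr.afEnd a r₀).R + 1) (2 * |a| + 1))
  obtain ⟨x, hx, hxR⟩ := (hev.and hfar).exists
  have hxe : (Kerr.afEnd a r₀).R < ‖x‖ := by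
    have := le_max_left ((Kerr.afEnd a r₀).R + 1) (2 * |a| + 1); linarith
  have hxa : 2 * |a| ≤ ‖x‖ := by
    have := le_max_right ((Kerr.afEnd a r₀).R + 1) (2 * |a| + 1); linarith
  have hx0 : 0 < ‖x‖ := lt_of_le_of_lt (Kerr.afEnd a r₀).R_pos.le hxe
  have hr : 0 < Kerr.radius a (E4.ofTimeSpace 0 x) :=
    (le_max_right _ _).trans_lt (Kerr.mem_slice.1 (Kerr.mem_slice_of_lt_norm hxe))
  -- read the eventual inequality at `x`
  have hnorm : ‖testForm M a r₀ hM.le M' x‖ ≤ M / 10 * ‖x‖⁻¹ := by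
    have e1 : ‖iteratedFDeriv ℝ 0 (fun y ↦ AFEnd.hCoeff (Kerr.afEnd a r₀) (Kerr.data M a r₀ hM.le) y -
        (1 + 2 * M' / ‖y‖) • (innerSL ℝ : E3 →L[ℝ] E3 →L[ℝ] ℝ)) x‖ = ‖testForm M a r₀ hM.le M' x‖ := by
      rw [norm_iteratedFDeriv_zero]; rfl
    have e2 : ‖(‖x‖ ^ (-(1:ℝ) - ((0:ℕ) : ℝ)))‖ = ‖x‖⁻¹ := by
      rw [Nat.cast_zero, sub_zero, Real.rpow_neg_one, Real.norm_of_nonneg (inv_nonneg.2 (norm_nonneg _))]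
    have h := hx
    rw [Real.norm_of_nonneg (norm_nonneg _), e1, e2] at h
    exact h
  -- the lower bound
  have hlow : 2 / 3 * (2 / 5 * M / ‖x‖) ≤ ‖testForm M a r₀ hM.le M' x‖ :=
    (mul_le_mul_of_nonneg_left (scalarH_slice_ge hM.le hr hxa hx0) (by norm_num)).trans
      (norm_testForm_ge hM.le M' hxe hr)
  rw [← div_eq_mul_inv] at hnorm
  have : 2 / 3 * (2 / 5 * M / ‖x‖) ≤ M / 10 / ‖x‖ := hlow.trans hnorm
  have key : (2 : ℝ) / 3 * (2 / 5 * M / ‖x‖) - M / 10 / ‖x‖ = M / 6 / ‖x‖ := by ring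
  have hpos : 0 < M / 6 / ‖x‖ := by positivity
  linarith

end UnbentEnd

end Summit.FinalStateConjecture.FinalStateConjecture.Theorems.KerrShieldedDataExist.Negative

end
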